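import Mathlib.Algebra.MvPolynomial.PDeriv
import Mathlib.Algebra.MvPolynomial.Degrees
import Mathlib.RingTheory.Derivation.Basic
import Mathlib.GroupTheory.QuotientGroup.Defs
import Mathlib.LinearAlgebra.Dimension.Finrank
import Mathlib.LinearAlgebra.FiniteDimensional.Defs
import Mathlib.LinearAlgebra.Prod
import Mathlib.LinearAlgebra.Span.Basic
import Mathlib.Data.Set.Card
import HarnessLib

/-!
# The linear group `𝔾ₐ^{d₀} × 𝔾ₘ^{d₁}` over a general field: points, invariant derivations, words, algebraic orders of vanishing, connected subgroups, the zero-estimate predicate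

Topic `Literature/NumberTheory/Transcendental` (namespace `Literature.NumberTheory.Transcendental`,
grouping sub-namespace `LinGroupK`). Vocabulary file: definitions with bodies and their unfolding
lemmas, everything stated PROVED; no named facts, nothing asserted.

It is the verbatim generalisation, from `ℂ` to an arbitrary field `K`, of the ALGEBRAIC part of the
tree's vocabulary for M. Waldschmidt's several-variable method on the commutative linear algebraic
group `G = 𝔾ₐ^{d₀} × 𝔾ₘ^{d₁}` (`Literature.NumberTheory.Transcendental.LinGroup`, `LinGroup.lean`, and
the algebraic half of `LinGroupDerivations.lean`, both hard-wired to `ℂ`). The purpose is the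
`p`-adic case `K = ℚ̄_p` of Waldschmidt's Theorem 4.1 [Waldschmidt1988] = Roy's Theorem 1
[Roy1992, §1] ("`K = ℂ` or `ℂ_p`"), whose proof (auxiliary function, zero estimate, §7 assembly)
is field-independent in its algebraic half, and whose zero estimate is to be TRANSPORTED from the
tree's complex theorem along an abstract field isomorphism `ℚ̄_p ≃+* ℂ`
(`Literature/FieldTheory/AlgClosed/PadicAlgClEquivComplex.lean`): for this the order of
vanishing must be the algebraic one (words of invariant derivations, [NesterenkoPhilippon2001,
Ch. 11, Lemma 3.3 / Prop. 3.6 (iii)]; over `ℂ` it is equivalent to the analytic one by the tree's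
`LinGroup.vanishesToOrder_iff_wordDeriv`).

* `LinGroupK K d₀ d₁` — the group `K^{d₀} × (Kˣ)^{d₁}` (multiplicative notation; for `K = ℂ` this
  is `LinGroup d₀ d₁` definitionally);
* `LinGroupK.coord`, `LinGroupK.evalAt`, `LinGroupK.degX`, `LinGroupK.degY` — affine coordinates
  `Fin d₀ ⊕ Fin d₁`, evaluation of `P ∈ K[X, Y]`, block degrees;
* `LinGroupK.invDeriv w` — `D_w = ∑ᵢ w₀ᵢ ∂/∂Xᵢ + ∑ₗ w₁ₗ Yₗ ∂/∂Yₗ` (a `Derivation`), additive and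
  homogeneous in `w`; `LinGroupK.wordDeriv u P = D_{u₀} ⋯ D_{u_{k−1}} P`, linear in `P`, with
  `wordDeriv_snoc`;
* `LinGroupK.VanishesAlg P W g N` — **algebraic order of vanishing** `ord_g P ≥ N` along `exp_G W`:
  all words of length `< N` with letters in `W` kill `P` at `g`; `vanishesAlg_span_iff` — it
  suffices to test words with letters in a spanning set (multilinearity in the letters);
* `LinGroupK.sumset S n` — Philippon's `Σ(n)`;
* `LinGroupK.ConnAlgSubgroup K d₀ d₁` — the connected algebraic subgroups `G' = E × T'` (`E` a
  `K`-subspace of `K^{d₀}`, `T'` the subtorus cut out by a saturated group of characters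
  `M ≤ ℤ^{d₁}`), `toSubgroup`, `torusTangent`, `tangent`, `addDim`, `torusDim`, `top`, `bot`;
* `LinGroupK.ZeroEstimate K d₀ d₁` — the PREDICATE "Philippon's zero estimate with multiplicities
  holds on `𝔾ₐ^{d₀} × 𝔾ₘ^{d₁}` over `K`" ([Philippon1986, Thm 2.1]; [Waldschmidt1988, Prop. 7.1]),
  in exactly the shape of the hypothesis `hZE` of the tree's complex assembly
  `LinGroup.weakObstruction_of_zeroEstimate_of_auxiliary` with the algebraic order of vanishing —
  a statement schema of `(K, d₀, d₁)`, nothing asserted.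

## References

* [Waldschmidt1988] M. Waldschmidt, *On the transcendence methods of Gel'fond and Schneider in
  several variables*, New Advances in Transcendence Theory (A. Baker ed.), CUP 1988, 375–398:
  §4 Theorem 4.1 (pp. 382–383), §7 Proposition 7.1 (p. 390).
* [Roy1992] D. Roy, *Matrices whose coefficients are linear forms in logarithms*, J. Number Theory
  41 (1992) 22–47, §1 Theorem 1 (p. 25) ("`K = ℂ` or `ℂ_p`", Notations p. 24).
* [Philippon1986] P. Philippon, *Lemmes de zéros dans les groupes algébriques commutatifs*,
  Bull. Soc. Math. France 114 (1986), 355–383, §2 (Théorème 2.1, `ord_g P`, `Σ(n)`).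
* [NesterenkoPhilippon2001] Yu. V. Nesterenko, P. Philippon (eds.), *Introduction to Algebraic
  Independence Theory*, LNM 1752, Springer 2001, Ch. 11 (D. Roy), §3 (Lemma 3.1, Def. 3.2,
  Lemma 3.3, Prop. 3.6 (iii)).
-/

noncomputable section

open MvPolynomial Module

namespace Literature.NumberTheory.Transcendental

/-- The points `K^{d₀} × (Kˣ)^{d₁}` of the commutative linear algebraic group `𝔾ₐ^{d₀} × 𝔾ₘ^{d₁}`
over a field `K`, as a multiplicative commutative group (for `K = ℂ` this is the tree's
`LinGroup d₀ d₁`). [cite: Waldschmidt1988, §4 (p. 382)] -/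
abbrev LinGroupK (K : Type*) [Field K] (d₀ d₁ : ℕ) : Type _ :=
  Multiplicative (Fin d₀ → K) × (Fin d₁ → Kˣ)

namespace LinGroupK

variable {K : Type*} [Field K] {d₀ d₁ : ℕ}

/-! ### Affine coordinates, evaluation, block degrees -/

/-- Affine coordinates of a point: `Sum.inl i` is the additive coordinate `xᵢ`, `Sum.inr j` the
multiplicative coordinate `yⱼ`. [folklore] -/
def coord (g : LinGroupK K d₀ d₁) : Fin d₀ ⊕ Fin d₁ → K :=
  Sum.elim (Multiplicative.toAdd g.1) (fun j => ((g.2 j : Kˣ) : K))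

/-- The additive coordinates. [folklore] -/
@[simp] theorem coord_inl (g : LinGroupK K d₀ d₁) (i : Fin d₀) :
    coord g (Sum.inl i) = Multiplicative.toAdd g.1 i := rfl

/-- The multiplicative coordinates. [folklore] -/
@[simp] theorem coord_inr (g : LinGroupK K d₀ d₁) (j : Fin d₁) :
    coord g (Sum.inr j) = (g.2 j : K) := rfl

/-- Value of `P ∈ K[X₁, …, X_{d₀}, Y₁, …, Y_{d₁}]` at the point `g ∈ G(K)`. [folklore] -/
def evalAt (P : MvPolynomial (Fin d₀ ⊕ Fin d₁) K) (g : LinGroupK K d₀ d₁) : K :=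
  MvPolynomial.eval (coord g) P

/-- `evalAt` unfolds to `MvPolynomial.eval`. [folklore] -/
theorem evalAt_eq_eval (P : MvPolynomial (Fin d₀ ⊕ Fin d₁) K) (g : LinGroupK K d₀ d₁) :
    evalAt P g = MvPolynomial.eval (coord g) P := rfl

/-- `evalAt` is additive in `P`. [folklore] -/
@[simp] theorem evalAt_add (P Q : MvPolynomial (Fin d₀ ⊕ Fin d₁) K) (g : LinGroupK K d₀ d₁) :
    evalAt (P + Q) g = evalAt P g + evalAt Q g := by
  simp [evalAt]

/-- `evalAt` is homogeneous in `P`. [folklore] -/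
@[simp] theorem evalAt_smul (c : K) (P : MvPolynomial (Fin d₀ ⊕ Fin d₁) K) (g : LinGroupK K d₀ d₁) :
    evalAt (c • P) g = c * evalAt P g := by
  simp [evalAt, MvPolynomial.smul_eval]

/-- `evalAt 0 = 0`. [folklore] -/
@[simp] theorem evalAt_zero (g : LinGroupK K d₀ d₁) :
    evalAt (0 : MvPolynomial (Fin d₀ ⊕ Fin d₁) K) g = 0 := by
  simp [evalAt]

/-- The total degree of `P` in the additive variables `X₁, …, X_{d₀}`.
[cite: Waldschmidt1988, §6 Proposition 6.1 (p. 389)] -/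
def degX (P : MvPolynomial (Fin d₀ ⊕ Fin d₁) K) : ℕ :=
  P.support.sup fun s => ∑ i, s (Sum.inl i)

/-- The total degree of `P` in the multiplicative variables `Y₁, …, Y_{d₁}`.
[cite: Waldschmidt1988, §6 Proposition 6.1 (p. 389)] -/
def degY (P : MvPolynomial (Fin d₀ ⊕ Fin d₁) K) : ℕ :=
  P.support.sup fun s => ∑ j, s (Sum.inr j)

/-- `degX P ≤ D ↔` every monomial of `P` has total `X`-degree `≤ D`. [folklore] -/
theorem degX_le_iff {P : MvPolynomial (Fin d₀ ⊕ Fin d₁) K} {D : ℕ} :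
    degX P ≤ D ↔ ∀ s ∈ P.support, ∑ i, s (Sum.inl i) ≤ D :=
  Finset.sup_le_iff

/-- `degY P ≤ D ↔` every monomial of `P` has total `Y`-degree `≤ D`. [folklore] -/
theorem degY_le_iff {P : MvPolynomial (Fin d₀ ⊕ Fin d₁) K} {D : ℕ} :
    degY P ≤ D ↔ ∀ s ∈ P.support, ∑ j, s (Sum.inr j) ≤ D :=
  Finset.sup_le_iff

/-- `degX 0 = 0`. [folklore] -/
@[simp] theorem degX_zero : degX (0 : MvPolynomial (Fin d₀ ⊕ Fin d₁) K) = 0 := by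
  simp [degX]

/-- `degY 0 = 0`. [folklore] -/
@[simp] theorem degY_zero : degY (0 : MvPolynomial (Fin d₀ ⊕ Fin d₁) K) = 0 := by
  simp [degY]

/-! ### Invariant derivations -/

/-- The invariant derivation attached to `w = (w₀, w₁) ∈ Lie G = K^{d₀} × K^{d₁}`:
`D_w = ∑ᵢ w₀ᵢ ∂/∂Xᵢ + ∑ₗ w₁ₗ · Yₗ ∂/∂Yₗ`. [cite: NesterenkoPhilippon2001, Ch. 11 Lemma 3.1] -/
def invDeriv (w : (Fin d₀ → K) × (Fin d₁ → K)) :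
    Derivation K (MvPolynomial (Fin d₀ ⊕ Fin d₁) K) (MvPolynomial (Fin d₀ ⊕ Fin d₁) K) :=
  ∑ i : Fin d₀, w.1 i • pderiv (Sum.inl i) +
    ∑ l : Fin d₁, w.2 l • ((X (Sum.inr l) : MvPolynomial (Fin d₀ ⊕ Fin d₁) K) • pderiv (Sum.inr l))

/-- Pointwise evaluation of a finite sum of derivations. [folklore] -/
theorem sum_derivation_apply {ι : Type*} (s : Finset ι)
    (D : ι → Derivation K (MvPolynomial (Fin d₀ ⊕ Fin d₁) K) (MvPolynomial (Fin d₀ ⊕ Fin d₁) K))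
    (P : MvPolynomial (Fin d₀ ⊕ Fin d₁) K) : (∑ j ∈ s, D j) P = ∑ j ∈ s, D j P := by
  classical
  induction s using Finset.induction_on with
  | empty => simp
  | insert a s ha ih => rw [Finset.sum_insert ha, Finset.sum_insert ha, Derivation.add_apply, ih]

/-- The formula `D_w P = ∑ᵢ w₀ᵢ ∂P/∂Xᵢ + ∑ₗ w₁ₗ Yₗ ∂P/∂Yₗ`. [folklore] -/
theorem invDeriv_apply (w : (Fin d₀ → K) × (Fin d₁ → K)) (P : MvPolynomial (Fin d₀ ⊕ Fin d₁) K) :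
    invDeriv w P = ∑ i : Fin d₀, w.1 i • pderiv (Sum.inl i) P +
      ∑ l : Fin d₁, w.2 l • (X (Sum.inr l) * pderiv (Sum.inr l) P) := by
  simp only [invDeriv, Derivation.add_apply, Derivation.smul_apply, sum_derivation_apply,
    smul_eq_mul]

/-- `D_w Xᵢ = w₀ᵢ` (a constant). [folklore] -/
@[simp] theorem invDeriv_X_inl (w : (Fin d₀ → K) × (Fin d₁ → K)) (i : Fin d₀) :
    invDeriv w (X (Sum.inl i) : MvPolynomial (Fin d₀ ⊕ Fin d₁) K) = C (w.1 i) := by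
  classical
  rw [invDeriv_apply]
  have h0 : ∀ i' : Fin d₀, pderiv (Sum.inl i') (X (Sum.inl i) : MvPolynomial (Fin d₀ ⊕ Fin d₁) K) =
      if i' = i then 1 else 0 := fun i' => by
    rw [pderiv_X]
    simp [Pi.single_apply, eq_comm]
  have h1 : ∀ l : Fin d₁, pderiv (Sum.inr l) (X (Sum.inl i) : MvPolynomial (Fin d₀ ⊕ Fin d₁) K) = 0 :=
    fun l => by rw [pderiv_X]; simp
  simp_rw [h0, h1, mul_zero, smul_zero, Finset.sum_const_zero, add_zero, smul_ite, smul_zero]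
  rw [Finset.sum_ite_eq' Finset.univ i]
  simp [MvPolynomial.smul_eq_C_mul]

/-- `D_w Yₗ = w₁ₗ Yₗ`. [folklore] -/
@[simp] theorem invDeriv_X_inr (w : (Fin d₀ → K) × (Fin d₁ → K)) (l : Fin d₁) :
    invDeriv w (X (Sum.inr l) : MvPolynomial (Fin d₀ ⊕ Fin d₁) K) = C (w.2 l) * X (Sum.inr l) := by
  classical
  rw [invDeriv_apply]
  have h0 : ∀ i : Fin d₀, pderiv (Sum.inl i) (X (Sum.inr l) : MvPolynomial (Fin d₀ ⊕ Fin d₁) K) = 0 :=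
    fun i => by rw [pderiv_X]; simp
  have h1 : ∀ l' : Fin d₁, pderiv (Sum.inr l') (X (Sum.inr l) : MvPolynomial (Fin d₀ ⊕ Fin d₁) K) =
      if l' = l then 1 else 0 := fun l' => by
    rw [pderiv_X]
    simp [Pi.single_apply, eq_comm]
  simp_rw [h0, h1, smul_zero, Finset.sum_const_zero, zero_add, mul_ite, mul_one, mul_zero,
    smul_ite, smul_zero]
  rw [Finset.sum_ite_eq' Finset.univ l]
  simp [MvPolynomial.smul_eq_C_mul]

/-- `D_w` kills constants. [folklore] -/
@[simp] theorem invDeriv_C (w : (Fin d₀ → K) × (Fin d₁ → K)) (a : K) :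
    invDeriv w (C a : MvPolynomial (Fin d₀ ⊕ Fin d₁) K) = 0 := by
  rw [← MvPolynomial.algebraMap_eq]
  exact (invDeriv w).map_algebraMap a

/-- `w ↦ D_w` is additive. [folklore] -/
theorem invDeriv_add (w w' : (Fin d₀ → K) × (Fin d₁ → K)) :
    invDeriv (d₀ := d₀) (d₁ := d₁) (w + w') = invDeriv w + invDeriv w' := by
  ext P : 1
  simp only [invDeriv_apply, Derivation.add_apply, Prod.fst_add, Prod.snd_add, Pi.add_apply,
    add_smul, Finset.sum_add_distrib]
  abel

/-- `w ↦ D_w` is homogeneous. [folklore] -/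
theorem invDeriv_smul (c : K) (w : (Fin d₀ → K) × (Fin d₁ → K)) :
    invDeriv (d₀ := d₀) (d₁ := d₁) (c • w) = c • invDeriv w := by
  ext P : 1
  simp only [invDeriv_apply, Derivation.smul_apply, Prod.smul_fst, Prod.smul_snd, Pi.smul_apply,
    smul_eq_mul, mul_smul, Finset.smul_sum, smul_add]

/-- `D_0 = 0`. [folklore] -/
@[simp] theorem invDeriv_zero : invDeriv (d₀ := d₀) (d₁ := d₁) (0 : (Fin d₀ → K) × (Fin d₁ → K)) = 0 := by
  have h := invDeriv_smul (d₀ := d₀) (d₁ := d₁) (0 : K) 0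
  rwa [zero_smul, zero_smul] at h

/-! ### Words of invariant derivations -/

/-- The word `D_{u₀} D_{u₁} ⋯ D_{u_{k-1}}` applied to `P` (letters applied from the right:
`wordDeriv u P = wordDeriv (init u) (D_{u_{k-1}} P)`). [cite: NesterenkoPhilippon2001, Ch. 11 Lemma 3.3] -/
def wordDeriv : {k : ℕ} → (Fin k → (Fin d₀ → K) × (Fin d₁ → K)) → MvPolynomial (Fin d₀ ⊕ Fin d₁) K →
    MvPolynomial (Fin d₀ ⊕ Fin d₁) K
  | 0, _, P => P
  | _ + 1, u, P => wordDeriv (Fin.init u) (invDeriv (u (Fin.last _)) P)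

/-- The empty word is the identity. [folklore] -/
@[simp] theorem wordDeriv_zero (u : Fin 0 → (Fin d₀ → K) × (Fin d₁ → K))
    (P : MvPolynomial (Fin d₀ ⊕ Fin d₁) K) : wordDeriv u P = P := rfl

/-- Recursion of words. [folklore] -/
theorem wordDeriv_succ {k : ℕ} (u : Fin (k + 1) → (Fin d₀ → K) × (Fin d₁ → K))
    (P : MvPolynomial (Fin d₀ ⊕ Fin d₁) K) :
    wordDeriv u P = wordDeriv (Fin.init u) (invDeriv (u (Fin.last k)) P) := rfl

/-- Appending a letter: `wordDeriv (snoc u t) P = wordDeriv u (D_t P)`. [folklore] -/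
theorem wordDeriv_snoc {k : ℕ} (u : Fin k → (Fin d₀ → K) × (Fin d₁ → K))
    (t : (Fin d₀ → K) × (Fin d₁ → K)) (P : MvPolynomial (Fin d₀ ⊕ Fin d₁) K) :
    wordDeriv (Fin.snoc u t) P = wordDeriv u (invDeriv t P) := by
  rw [wordDeriv_succ, Fin.init_snoc, Fin.snoc_last]

/-- A constant word is an iterate: `wordDeriv (u, …, u) P = D_u^k P`. [folklore] -/
theorem wordDeriv_const (k : ℕ) (u : (Fin d₀ → K) × (Fin d₁ → K)) (P : MvPolynomial (Fin d₀ ⊕ Fin d₁) K) :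
    wordDeriv (fun _ : Fin k => u) P = (invDeriv u)^[k] P := by
  induction k generalizing P with
  | zero => rfl
  | succ k ih =>
    rw [wordDeriv_succ, Function.iterate_succ_apply]
    exact ih (invDeriv u P)

/-- Words kill `0`. [folklore] -/
@[simp] theorem wordDeriv_zero_right {k : ℕ} (u : Fin k → (Fin d₀ → K) × (Fin d₁ → K)) :
    wordDeriv u (0 : MvPolynomial (Fin d₀ ⊕ Fin d₁) K) = 0 := by
  induction k with
  | zero => rfl
  | succ k ih => rw [wordDeriv_succ, map_zero, ih]

/-- Words are additive in `P`. [folklore] -/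
theorem wordDeriv_add {k : ℕ} (u : Fin k → (Fin d₀ → K) × (Fin d₁ → K))
    (Q R : MvPolynomial (Fin d₀ ⊕ Fin d₁) K) : wordDeriv u (Q + R) = wordDeriv u Q + wordDeriv u R := by
  induction k generalizing Q R with
  | zero => rfl
  | succ k ih => rw [wordDeriv_succ, wordDeriv_succ, wordDeriv_succ, map_add, ih]

/-- Words are homogeneous in `P`. [folklore] -/
theorem wordDeriv_smul {k : ℕ} (u : Fin k → (Fin d₀ → K) × (Fin d₁ → K)) (c : K)
    (Q : MvPolynomial (Fin d₀ ⊕ Fin d₁) K) : wordDeriv u (c • Q) = c • wordDeriv u Q := by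
  induction k generalizing Q with
  | zero => rfl
  | succ k ih => rw [wordDeriv_succ, wordDeriv_succ, Derivation.map_smul, ih]

/-- Words kill constants as soon as they are non-empty. [folklore] -/
theorem wordDeriv_C_of_pos {k : ℕ} (hk : 0 < k) (u : Fin k → (Fin d₀ → K) × (Fin d₁ → K)) (a : K) :
    wordDeriv u (C a : MvPolynomial (Fin d₀ ⊕ Fin d₁) K) = 0 := by
  obtain ⟨k, rfl⟩ : ∃ k', k = k' + 1 := ⟨k - 1, by omega⟩
  rw [wordDeriv_succ, invDeriv_C, wordDeriv_zero_right]

/-! ### Algebraic order of vanishing along `exp_G(W)` -/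

/-- **Algebraic order of vanishing** `ord_g P ≥ N` along the subgroup `exp_G(W)` attached to a
subspace `W ⊆ Lie G`: every word `D_{u₀} ⋯ D_{u_{k-1}}` of length `k < N` with letters `uᵢ ∈ W`
kills `P` at `g`. Over `ℂ` this is equivalent to the analytic definition (all Fréchet derivatives
of order `< N` at `0` of `w ↦ P(g · exp_G w)` on `W` vanish) by the tree's
`LinGroup.vanishesToOrder_iff_wordDeriv`. [cite: NesterenkoPhilippon2001, Ch. 11 Lemma 3.3 and Prop. 3.6 (iii)]
[cite: Philippon1986, §2] -/
def VanishesAlg (P : MvPolynomial (Fin d₀ ⊕ Fin d₁) K) (W : Submodule K ((Fin d₀ → K) × (Fin d₁ → K)))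
    (g : LinGroupK K d₀ d₁) (N : ℕ) : Prop :=
  ∀ k < N, ∀ u : Fin k → (Fin d₀ → K) × (Fin d₁ → K), (∀ i, u i ∈ W) → evalAt (wordDeriv u P) g = 0

/-- Order `≥ 0` is no condition. [folklore] -/
@[simp] theorem vanishesAlg_zero (P : MvPolynomial (Fin d₀ ⊕ Fin d₁) K)
    (W : Submodule K ((Fin d₀ → K) × (Fin d₁ → K))) (g : LinGroupK K d₀ d₁) : VanishesAlg P W g 0 :=
  fun _k hk => absurd hk (Nat.not_lt_zero _)

/-- Order `≥ 1` along any subgroup just means `P(g) = 0`. [folklore] -/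
theorem vanishesAlg_one_iff (P : MvPolynomial (Fin d₀ ⊕ Fin d₁) K)
    (W : Submodule K ((Fin d₀ → K) × (Fin d₁ → K))) (g : LinGroupK K d₀ d₁) :
    VanishesAlg P W g 1 ↔ evalAt P g = 0 := by
  constructor
  · intro h
    simpa using h 0 Nat.zero_lt_one (fun i => Fin.elim0 i) (fun i => Fin.elim0 i)
  · intro h k hk u _
    obtain rfl : k = 0 := Nat.lt_one_iff.mp hk
    simpa using h

/-- Positive order forces `P(g) = 0`. [folklore] -/
theorem VanishesAlg.evalAt_eq_zero {P : MvPolynomial (Fin d₀ ⊕ Fin d₁) K}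
    {W : Submodule K ((Fin d₀ → K) × (Fin d₁ → K))} {g : LinGroupK K d₀ d₁} {N : ℕ}
    (h : VanishesAlg P W g N) (hN : 0 < N) : evalAt P g = 0 := by
  simpa using h 0 hN (fun i => Fin.elim0 i) (fun i => Fin.elim0 i)

/-- Order `≥ N` implies order `≥ N'` for `N' ≤ N`. [folklore] -/
theorem VanishesAlg.mono {P : MvPolynomial (Fin d₀ ⊕ Fin d₁) K}
    {W : Submodule K ((Fin d₀ → K) × (Fin d₁ → K))} {g : LinGroupK K d₀ d₁} {N N' : ℕ}
    (h : VanishesAlg P W g N) (hN : N' ≤ N) : VanishesAlg P W g N' :=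
  fun k hk => h k (lt_of_lt_of_le hk hN)

/-- Order of vanishing is monotone in the subspace: letters in a smaller `W'` are letters in `W`.
[folklore] -/
theorem VanishesAlg.anti {P : MvPolynomial (Fin d₀ ⊕ Fin d₁) K}
    {W W' : Submodule K ((Fin d₀ → K) × (Fin d₁ → K))} {g : LinGroupK K d₀ d₁} {N : ℕ}
    (h : VanishesAlg P W g N) (hW : W' ≤ W) : VanishesAlg P W' g N :=
  fun k hk u hu => h k hk u fun i => hW (hu i)

/-- Along `W = 0` any order of vanishing `≥ 1` is just `P(g) = 0` (non-empty words with the letter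
`0` vanish identically). [folklore] -/
theorem vanishesAlg_bot_iff (P : MvPolynomial (Fin d₀ ⊕ Fin d₁) K) (g : LinGroupK K d₀ d₁) {N : ℕ}
    (hN : 0 < N) : VanishesAlg P ⊥ g N ↔ evalAt P g = 0 := by
  refine ⟨fun h => h.evalAt_eq_zero hN, fun h k hk u hu => ?_⟩
  cases k with
  | zero => simpa using h
  | succ k =>
    have hu' : u (Fin.last k) = 0 := by simpa using hu (Fin.last k)
    rw [wordDeriv_succ, hu', invDeriv_zero, Derivation.zero_apply, wordDeriv_zero_right, evalAt_zero]

/-- **Words with letters in a spanning set suffice** (multilinearity of `u ↦ (D_u P)(g)` in the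
letters): if every word of length `k` with letters in `S` kills `P` at `g`, so does every word of
length `k` with letters in `span_K S`. [folklore] -/
theorem evalAt_wordDeriv_eq_zero_of_span (g : LinGroupK K d₀ d₁) (S : Set ((Fin d₀ → K) × (Fin d₁ → K)))
    {k : ℕ} (P : MvPolynomial (Fin d₀ ⊕ Fin d₁) K)
    (h : ∀ s : Fin k → (Fin d₀ → K) × (Fin d₁ → K), (∀ i, s i ∈ S) → evalAt (wordDeriv s P) g = 0)
    (u : Fin k → (Fin d₀ → K) × (Fin d₁ → K)) (hu : ∀ i, u i ∈ Submodule.span K S) :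
    evalAt (wordDeriv u P) g = 0 := by
  induction k generalizing P with
  | zero =>
    simpa using h (fun i => Fin.elim0 i) (fun i => Fin.elim0 i)
  | succ k ih =>
    rw [wordDeriv_succ]
    -- the value is `K`-linear in the last letter; reduce to letters in `S`
    have key : ∀ t ∈ Submodule.span K S,
        evalAt (wordDeriv (Fin.init u) (invDeriv t P)) g = 0 := by
      intro t ht
      induction ht using Submodule.span_induction with
      | mem t ht =>
        refine ih (invDeriv t P) (fun s hs => ?_) (Fin.init u) (fun i => hu (Fin.castSucc i))
        have := h (Fin.snoc s t) (fun i => by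
          refine Fin.lastCases ?_ (fun j => ?_) i
          · simpa using ht
          · simpa using hs j)
        rwa [wordDeriv_snoc] at this
      | zero => rw [invDeriv_zero, Derivation.zero_apply, wordDeriv_zero_right, evalAt_zero]
      | add t t' _ _ iht iht' =>
        rw [invDeriv_add, Derivation.add_apply, wordDeriv_add, evalAt_add, iht, iht', add_zero]
      | smul c t _ iht =>
        rw [invDeriv_smul, Derivation.smul_apply, wordDeriv_smul, evalAt_smul, iht, mul_zero]
    exact key _ (hu (Fin.last k))

/-- **Order of vanishing along `span_K S` is tested on words with letters in `S`.** [folklore] -/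
theorem vanishesAlg_span_iff (P : MvPolynomial (Fin d₀ ⊕ Fin d₁) K) (S : Set ((Fin d₀ → K) × (Fin d₁ → K)))
    (g : LinGroupK K d₀ d₁) (N : ℕ) :
    VanishesAlg P (Submodule.span K S) g N ↔
      ∀ k < N, ∀ s : Fin k → (Fin d₀ → K) × (Fin d₁ → K), (∀ i, s i ∈ S) →
        evalAt (wordDeriv s P) g = 0 :=
  ⟨fun h k hk s hs => h k hk s fun i => Submodule.subset_span (hs i),
    fun h k hk u hu => evalAt_wordDeriv_eq_zero_of_span g S P (h k hk) u hu⟩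

/-! ### Philippon's `Σ(n)` -/

/-- Philippon's `Σ(n) = {x₁ ⋯ x_n ; xᵢ ∈ Σ}` (multiplicative notation; `Σ(0) = {e}`).
[cite: Philippon1986, §2] -/
def sumset (S : Set (LinGroupK K d₀ d₁)) (n : ℕ) : Set (LinGroupK K d₀ d₁) :=
  {g | ∃ σ : Fin n → LinGroupK K d₀ d₁, (∀ i, σ i ∈ S) ∧ g = ∏ i, σ i}

/-- `Σ(0) = {e}`. [folklore] -/
theorem sumset_zero (S : Set (LinGroupK K d₀ d₁)) : sumset S 0 = {1} := by
  ext g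
  simp [sumset]

/-- If `e ∈ S` then `S ⊆ Σ(n)` for `n ≥ 1`. [folklore] -/
theorem subset_sumset {S : Set (LinGroupK K d₀ d₁)} (hS : (1 : LinGroupK K d₀ d₁) ∈ S) {n : ℕ}
    (hn : 1 ≤ n) : S ⊆ sumset S n := by
  intro g hg
  obtain ⟨k, rfl⟩ : ∃ k, n = k + 1 := ⟨n - 1, by omega⟩
  refine ⟨Fin.cons g (fun _ => 1), ?_, ?_⟩
  · refine Fin.cases ?_ (fun i => ?_) <;> simp [hg, hS]
  · simp [Fin.prod_univ_succ]

/-- `Σ(n)` is monotone in `S`. [folklore] -/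
theorem sumset_mono {S S' : Set (LinGroupK K d₀ d₁)} (h : S ⊆ S') (n : ℕ) : sumset S n ⊆ sumset S' n := by
  rintro g ⟨σ, hσ, rfl⟩
  exact ⟨σ, fun i => h (hσ i), rfl⟩

/-! ### Connected algebraic subgroups `E × T'` -/

variable (K) in
/-- **Connected algebraic subgroups of `𝔾ₐ^{d₀} × 𝔾ₘ^{d₁}`** over a field of characteristic `0`:
`E × T'` with `E` a vector subgroup of `𝔾ₐ^{d₀}` (an arbitrary `K`-subspace, `addPart`) and
`T' = {y ; y^χ = 1 ∀ χ ∈ M}` the subtorus cut out by a subgroup `M ≤ ℤ^{d₁}` of characters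
(`chars`); `T'` is connected iff `M` is saturated. (For `K = ℂ` these are the data of the tree's
`LinGroup.ConnAlgSubgroup`.) [folklore] -/
structure ConnAlgSubgroup (d₀ d₁ : ℕ) where
  /-- The vector part `E ⊆ K^{d₀}`. -/
  addPart : Submodule K (Fin d₀ → K)
  /-- The characters `χ ∈ ℤ^{d₁}` of `𝔾ₘ^{d₁}` that are trivial on the torus part. -/
  chars : AddSubgroup (Fin d₁ → ℤ)
  /-- Saturation of the character lattice (= connectedness of the subtorus). -/
  saturated : ∀ (k : ℤ) (χ : Fin d₁ → ℤ), k ≠ 0 → k • χ ∈ chars → χ ∈ chars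

namespace ConnAlgSubgroup

/-- The group of `K`-points of `G' = E × T'`. [folklore] -/
def toSubgroup (H : ConnAlgSubgroup K d₀ d₁) : Subgroup (LinGroupK K d₀ d₁) where
  carrier := {g | Multiplicative.toAdd g.1 ∈ H.addPart ∧
    ∀ χ ∈ H.chars, ∏ j, (g.2 j) ^ (χ j) = 1}
  one_mem' := by simp
  mul_mem' := by
    rintro ⟨a, y⟩ ⟨a', y'⟩ ⟨ha, hy⟩ ⟨ha', hy'⟩
    refine ⟨?_, fun χ hχ => ?_⟩
    · simpa [toAdd_mul] using H.addPart.add_mem ha ha'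
    · have e : ∏ j, ((y * y') j) ^ (χ j) = (∏ j, (y j) ^ (χ j)) * ∏ j, (y' j) ^ (χ j) := by
        simp [mul_zpow, Finset.prod_mul_distrib]
      have h1 : ∏ j, (y j) ^ (χ j) = 1 := hy χ hχ
      have h2 : ∏ j, (y' j) ^ (χ j) = 1 := hy' χ hχ
      show ∏ j, ((y * y') j) ^ (χ j) = 1
      rw [e, h1, h2, one_mul]
  inv_mem' := by
    rintro ⟨a, y⟩ ⟨ha, hy⟩
    refine ⟨?_, fun χ hχ => ?_⟩
    · simpa [toAdd_inv] using H.addPart.neg_mem ha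
    · have e : ∏ j, ((y⁻¹) j) ^ (χ j) = (∏ j, (y j) ^ (χ j))⁻¹ := by
        simp [Finset.prod_inv_distrib]
      have h1 : ∏ j, (y j) ^ (χ j) = 1 := hy χ hχ
      show ∏ j, ((y⁻¹) j) ^ (χ j) = 1
      rw [e, h1, inv_one]

/-- Membership in `G' = E × T'`. [folklore] -/
theorem mem_toSubgroup_iff (H : ConnAlgSubgroup K d₀ d₁) (g : LinGroupK K d₀ d₁) :
    g ∈ H.toSubgroup ↔ Multiplicative.toAdd g.1 ∈ H.addPart ∧
      ∀ χ ∈ H.chars, ∏ j, (g.2 j) ^ (χ j) = 1 := Iff.rfl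

/-- The Lie algebra of the torus part: `{v ∈ K^{d₁} ; ∑ⱼ χⱼ vⱼ = 0 for all χ ∈ M}`. [folklore] -/
def torusTangent (H : ConnAlgSubgroup K d₀ d₁) : Submodule K (Fin d₁ → K) where
  carrier := {v | ∀ χ ∈ H.chars, ∑ j, (χ j : K) * v j = 0}
  zero_mem' := by simp
  add_mem' := by
    intro v v' hv hv' χ hχ
    simp only [Pi.add_apply, mul_add, Finset.sum_add_distrib, hv χ hχ, hv' χ hχ, add_zero]
  smul_mem' := by
    intro c v hv χ hχ
    simp only [Pi.smul_apply, smul_eq_mul, mul_left_comm _ c, ← Finset.mul_sum, hv χ hχ,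
      mul_zero]

/-- Membership in `Lie T'`. [folklore] -/
theorem mem_torusTangent_iff (H : ConnAlgSubgroup K d₀ d₁) (v : Fin d₁ → K) :
    v ∈ H.torusTangent ↔ ∀ χ ∈ H.chars, ∑ j, (χ j : K) * v j = 0 := Iff.rfl

/-- The Lie algebra `Lie G' = E × Lie T' ≤ Lie G = K^{d₀} × K^{d₁}` of `G' = E × T'`. [folklore] -/
def tangent (H : ConnAlgSubgroup K d₀ d₁) : Submodule K ((Fin d₀ → K) × (Fin d₁ → K)) :=
  H.addPart.prod H.torusTangent

/-- Membership in `Lie G'`. [folklore] -/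
theorem mem_tangent_iff (H : ConnAlgSubgroup K d₀ d₁) (w : (Fin d₀ → K) × (Fin d₁ → K)) :
    w ∈ H.tangent ↔ w.1 ∈ H.addPart ∧ w.2 ∈ H.torusTangent := Submodule.mem_prod

/-- Dimension `dim E` of the vector part. [folklore] -/
def addDim (H : ConnAlgSubgroup K d₀ d₁) : ℕ := Module.finrank K H.addPart

/-- Dimension `dim T' = dim Lie T'` of the torus part. [folklore] -/
def torusDim (H : ConnAlgSubgroup K d₀ d₁) : ℕ := Module.finrank K H.torusTangent

variable (K) in
/-- The whole group `G` (`E = K^{d₀}`, `M = 0`). [folklore] -/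
def top (d₀ d₁ : ℕ) : ConnAlgSubgroup K d₀ d₁ where
  addPart := ⊤
  chars := ⊥
  saturated := by
    intro k χ hk h
    rw [AddSubgroup.mem_bot] at h ⊢
    exact (smul_eq_zero.mp h).resolve_left hk

variable (K) in
/-- The trivial subgroup `{e}` (`E = 0`, `M = ℤ^{d₁}`). [folklore] -/
def bot (d₀ d₁ : ℕ) : ConnAlgSubgroup K d₀ d₁ where
  addPart := ⊥
  chars := ⊤
  saturated := fun _ _ _ _ => AddSubgroup.mem_top _

/-- Every point lies in `top`. [folklore] -/
@[simp] theorem mem_toSubgroup_top (g : LinGroupK K d₀ d₁) : g ∈ (top K d₀ d₁).toSubgroup := by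
  simp [top, mem_toSubgroup_iff]

/-- The Lie algebra of `top` is everything. [folklore] -/
@[simp] theorem tangent_top : (top K d₀ d₁).tangent = ⊤ := by
  rw [tangent, Submodule.prod_eq_top_iff]
  refine ⟨rfl, ?_⟩
  rw [eq_top_iff]
  intro v _ χ hχ
  simp only [top, AddSubgroup.mem_bot] at hχ
  simp [hχ]

/-- `bot` is the trivial subgroup. [folklore] -/
theorem mem_toSubgroup_bot_iff (g : LinGroupK K d₀ d₁) : g ∈ (bot K d₀ d₁).toSubgroup ↔ g = 1 := by
  constructor
  · rintro ⟨h1, h2⟩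
    ext i
    · have : Multiplicative.toAdd g.1 = 0 := by simpa [bot] using h1
      simp [this]
    · have := h2 (Pi.single i 1) (AddSubgroup.mem_top _)
      rw [Finset.prod_eq_single i (fun b _ hb => by simp [Pi.single_eq_of_ne hb])
        (fun h => absurd (Finset.mem_univ i) h)] at this
      simpa using this
  · rintro rfl
    simp [bot]

/-- The Lie algebra of `bot` is zero (characteristic `0`: the coordinate characters `eⱼ ∈ M = ℤ^{d₁}`
force `v = 0`). [folklore] -/
@[simp] theorem tangent_bot [CharZero K] : (bot K d₀ d₁).tangent = ⊥ := by
  rw [tangent, Submodule.prod_eq_bot_iff]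
  refine ⟨rfl, ?_⟩
  rw [eq_bot_iff]
  intro v hv
  rw [Submodule.mem_bot]
  funext j
  have := hv (Pi.single j 1) (AddSubgroup.mem_top _)
  rw [Finset.sum_eq_single j (fun b _ hb => by simp [Pi.single_eq_of_ne hb])
    (fun h => absurd (Finset.mem_univ j) h)] at this
  simpa using this

end ConnAlgSubgroup

/-! ### The zero estimate with multiplicities, as a predicate of `(K, d₀, d₁)` -/

variable (K) in
/-- **Philippon's zero estimate with multiplicities on `𝔾ₐ^{d₀} × 𝔾ₘ^{d₁}` over `K`, as a
PREDICATE** (a statement schema of `(K, d₀, d₁)`; nothing asserted): there is a constant `c`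
(depending only on `d₀, d₁`) such that for all `D₀, D₁ ≥ 1`, `T`, every subspace `W ≠ 0` of
`Lie G`, every finite `Σ ∋ e` and every non-zero `P` of degree `≤ D₀` in `X`, `≤ D₁` in `Y`
vanishing to order `≥ (d₀ + d₁)T + 1` along `exp_G W` at every point of `Σ(d₀ + d₁)`, there is a
connected algebraic subgroup `G' = E × T'` contained in a translate of the zero locus of `P` with
`binom(T + codim_W(W ∩ Lie G'), codim) · card((Σ·G')/G') · D₀^{dim E} D₁^{dim T'} ≤ c D₀^{d₀} D₁^{d₁}`
— [Philippon1986, Thm 2.1] for this group ([Waldschmidt1988, Prop. 7.1], "a special case of the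
main result of [8]"), verbatim the hypothesis `hZE` of the tree's complex assembly
`LinGroup.weakObstruction_of_zeroEstimate_of_auxiliary` with the ALGEBRAIC order of vanishing
`VanishesAlg`. For `K = ℂ`, `d₀ = 1` it is (up to that dictionary) the tree's theorem
`Philippon1986_GaGm_holds`. [cite: Philippon1986, Thm 2.1] [cite: Waldschmidt1988, §7 Proposition 7.1 (p. 390)] -/
def ZeroEstimate (d₀ d₁ : ℕ) : Prop :=
  ∃ c : ℕ, ∀ (D₀ D₁ T : ℕ) (W : Submodule K ((Fin d₀ → K) × (Fin d₁ → K)))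
      (S : Set (LinGroupK K d₀ d₁)) (P : MvPolynomial (Fin d₀ ⊕ Fin d₁) K),
    1 ≤ D₀ → 1 ≤ D₁ → 0 < finrank K W → S.Finite → (1 : LinGroupK K d₀ d₁) ∈ S → P ≠ 0 →
    degX P ≤ D₀ → degY P ≤ D₁ →
    (∀ g ∈ sumset S (d₀ + d₁), VanishesAlg P W g ((d₀ + d₁) * T + 1)) →
    ∃ H : ConnAlgSubgroup K d₀ d₁,
      (∃ g : LinGroupK K d₀ d₁, ∀ h ∈ H.toSubgroup, evalAt P (g * h) = 0) ∧
      Nat.choose (T + (finrank K W - finrank K ↥(W ⊓ H.tangent)))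
          (finrank K W - finrank K ↥(W ⊓ H.tangent)) *
        Set.ncard ((QuotientGroup.mk : LinGroupK K d₀ d₁ → LinGroupK K d₀ d₁ ⧸ H.toSubgroup) '' S) *
        D₀ ^ H.addDim * D₁ ^ H.torusDim ≤ c * D₀ ^ d₀ * D₁ ^ d₁

end LinGroupK

end Literature.NumberTheory.Transcendental
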